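/-
b2b-lace packet, LEAN TYPING SEAT 2 gen 17 (unit `b2b-lace-lean2-g17`; theorem 1 staged by gen 16).  (S2b)-IMPR, the ASSEMBLY of [NoBLE17] §3.3.5
with every landed leaf consumed BY NAME and carried to the doorstep of the numeric certificate: REFEREE v72 ORDERS (5) — (H-Γ) and (H-T) of DIVERGENCE
D79 appear as the NAMED hypotheses `hΓ`, `hT` exactly where `NobleH2Step` is consumed; the only displayed ANALYTIC input is the Step-1 bound ([NoBLE17]
(3.61)–(3.71); node L3, DIVERGENCE D80), stated in the leaf shape of the other four steps and quantified over the simplified-form witnesses so that the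
Step-1 leaf discharges it by one function application when it lands.  Additive: no existing module is modified; d-generic; no numeral; no named fact.
-/
import Literature.Probability.FitznerVanDerHofstad2017.NobleH2Step
import Literature.Probability.FitznerVanDerHofstad2017.NobleH35Step
import Literature.Probability.FitznerVanDerHofstad2017.NobleWeightedDiagramAssembly
import Literature.Probability.FitznerVanDerHofstad2017.NobleLapAtomsIntegrable
import Literature.Probability.FitznerVanDerHofstad2017.NobleRemainderSymmetrisation
import Literature.Probability.FitznerVanDerHofstad2017.NobleF3InitialPoint
import HarnessLib

/-!
# Literature.Probability.FitznerVanDerHofstad2017.NobleWeightedDiagramBound — `|ℋ^{n,l}_p(x)| ≤ boundHD75 τ n l x r` and the six cells of `f₃`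

CITATION HEADER (PLACEMENT v2). Part of a certified REPRODUCTION of R. Fitzner, R. van der Hofstad, *Generalized approach to the non-backtracking
lace expansion*, Probab. Theory Related Fields 169 (2017) 1041–1119 [NoBLE17] and *Mean-field behavior for nearest-neighbor percolation in `d > 10`*,
Electron. J. Probab. 22 (2017) no. 43 [FvdH17].  This module is COMPOSITION ONLY (no new estimate): it joins the landed pieces of [NoBLE17] §3.3.5,

* the App.-C split and the triangle inequality over the five pieces — `abs_nobleH_le_boundHD75_of_pieces` (module `NobleWeightedDiagramAssembly`;
  Step 4 in the Appendix-C-consistent form `boundH4D75`, DIVERGENCE D75, discharged inside it),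
* the integrability of the five pieces — `integrable_piece_H1…5` (`NobleLapAtomsIntegrable`),
* Step 2 — `abs_integral_H2_diagram_le_boundH2_lapAtomsAt` (`NobleH2Step`; hypotheses `r.WF`, **(H-Γ)** `Γ₂′ⁿ β_{R,Φ} ≤ β_{ΔR,Φ}` and **(H-T)**
  `TS_{m,l}(x) := K_{m,l+1}(x) + (2/α̲_F) U_{m+1,l}(x) ≤ τ.T m l x` — DIVERGENCE D79 (notebook ≠ print in the slot convention; conservative in the coded
  direction at the record tuple, AGREE §4ap); they are DISPLAYED here as `hΓ`, `hT`, not derived),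
* Steps 3 and 5 — `abs_integral_H3/H5_diagram_le_boundH3/H5_lapAtomsAt` (`NobleH35Step`; hypothesis `τ.U = srwU`),
* the witnesses of the extended simplified form with their key-quantity bounds — `NobleSimplifiedFormF3At.exists_keyBounds_and_split`
  (`NobleRemainderSymmetrisation`), repackaged as the record `NobleF3Witness` (a CODING PREDICATE naming the twenty conjuncts; not a fact),
* the cell assembly over `𝒮 = nobleTriple d` — `nobleSupH_le_of_forall` (`NobleF3InitialPoint`),

into: (1) `abs_nobleH_le_boundHD75_of_step1` — fixed witnesses; (2) `abs_nobleH_le_boundHD75_of_witness` — from `∃ witnesses, NobleF3Witness …`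
(delivered below `p_c` under `f₂ ≤ Γ₂` by `NobleSimplifiedFormF3At.exists_witness`), with the Step-1 bound displayed as ONE binder `hStep1`
quantified over the witnesses; (3) `nobleWeightedDiagramBoundAt_of_witness` — for `d ≥ 9`, the six cells of [FvdH17] (2.23):
`sup_{x ∈ S_k} ℋ^{n_k,l_k}_p(x) ≤ b_k`, i.e. `NobleWeightedDiagramBoundAt d p b` (module `NobleInstantiate`), from (2) at `n ∈ {0,1}` and the six
per-cell NUMERIC hypotheses `boundHD75 τ n_k l_k x r ≤ b_k (x ∈ S_k)` — the shape the numeric certificate discharges ([NoBLE17] (3.87), [FvdH17] §2.5);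
(4) `nobleImprovementInputsAt_of_simplifiedFormF3` — (3) together with the projection `NobleSimplifiedFormF3At.toSimplifiedFormAt`, packaged over the
window `p ∈ (p_I, p_c)`, `f_i(p) ≤ Γ_i`, as the improvement-step input `NobleImprovementInputsAt d cμ c Γ B b` that the numeric-certificate theorems
(`meanField_of_certificate` and its instances) display as their hypothesis `hS`.
What remains displayed after this module: Step 1 (`hStep1`; the Step-1 leaf is node L3), the table side `τ.K = srwK`, `τ.U = srwU`, `srwTS ≤ τ.T`
(node L8) and the per-cell numerics.  No dimension-specific sentence is made here.
[cite: FitznerVanDerHofstad2016NoBLE, §3.3.5 (3.58)–(3.59) p. 1074, Steps 1–5 (3.60)–(3.87) pp. 1075–1079; §2.1 (the set 𝒮) p. 1049;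
 §3.3.4 (3.40)–(3.57) pp. 1072–1074]
[cite: FitznerVanDerHofstad2017, (2.21)–(2.23) and §2.5 (EJP pp. 8–9, 11–12); notebook General.nb In[2]–In[3] `BoundH[1..5]`, `BoundHn`]
-/

noncomputable section

open MeasureTheory Real
open Literature.Barriers.CriticalPhenomena
open Literature.Barriers.CriticalPhenomena.Slade2006Prop53 (P)
open Literature.Probability.LatticeModels
open Literature.Probability.Percolation
open Literature.Probability.RandomPlanarGeometry.SAW.Zd (normSq)

namespace Literature.Probability.FitznerVanDerHofstad2017

variable {d : ℕ}

/-! ## 1. Fixed witnesses: Steps 2–5 by name, Step 1 displayed -/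

/-- **`|ℋ^{n,l}_p(x)| ≤ F3Bounds.boundHD75 τ n l x r`** below `p_c`, for `d ≥ 2n + 7`, a simplified-form witness with summable remainders of finite
absolute second moment whose atoms obey `KeyBounds r` on the cube off `{D̂ = 1}`, well-formed arguments `r` satisfying (H-Γ), a table `τ` with
`K = srwK`, `U = srwU`, `srwTS ≤ T` ((H-T)), GIVEN the Step-1 bound `hH1`.  (H-Γ), (H-T): DIVERGENCE D79 (displayed, not derived).
[cite: FitznerVanDerHofstad2016NoBLE, §3.3.5 (3.58)–(3.59), (3.61), (3.72)–(3.87), PTRF pp. 1074–1079] -/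
theorem abs_nobleH_le_boundHD75_of_step1 {n : ℕ} (hd : 2 * (n + 3) + 1 ≤ d) {p : unitInterval}
    (hp : (p : ℝ) < criticalProb (zdGraph d) (0 : Site d)) {cΦ αΦ cF αF : ℝ} {RΦ RF : Site d → ℝ}
    (hRΦ : Summable RΦ) (hRF : Summable RF) (hRΦ2 : Summable fun x => normSq x * |RΦ x|)
    (hRF2 : Summable fun x => normSq x * |RF x|)
    (hform : ∀ k ∈ cube d,
      tauHat d p k * (1 - (cF + αF * Dhat d k + cosFT RF k)) = cΦ + αΦ * Dhat d k + cosFT RΦ k)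
    {r : F3Bounds.Args} (hKB : ∀ k ∈ cube d, Dhat d k < 1 → (lapAtomsAt d cΦ αΦ cF αF RΦ RF k).KeyBounds r)
    (hr : r.WF) (hΓ : r.Gamma2dash ^ n * r.bRp ≤ r.bRpDelta)
    (τ : F3Bounds.Tables (Fin d → ℤ)) (hK : ∀ m l x, τ.K m l x = srwK d m l x) (hU : ∀ m l x, τ.U m l x = srwU d m l x)
    (hT : ∀ m l x, srwTS d r.afmin m l x ≤ τ.T m l x) (l : ℕ) (x : Site d)
    (hH1 : |(∫ k, (lapAtomsAt d cΦ αΦ cF αF RΦ RF k).H1 * (lapAtomsAt d cΦ αΦ cF αF RΦ RF k).G ^ n *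
        Dhat d k ^ l * DhatSym d x k ∂P d) / (2 * π) ^ d| ≤ F3Bounds.boundH1 τ n l x r) :
    |nobleH d n l p x| ≤ F3Bounds.boundHD75 τ n l x r :=
  have hd' : 2 * (n + 2) + 1 ≤ d := by omega
  abs_nobleH_le_boundHD75_of_pieces hd' hp hRΦ hRF hRΦ2 hRF2 hform hKB τ hK l x
    (integrable_piece_H1 hd' hRΦ hRF hRΦ2 hRF2 hKB l x) (integrable_piece_H2 hd' hRΦ hRF hRΦ2 hRF2 hKB l x)
    (integrable_piece_H3 hd' hRΦ hRF hRΦ2 hRF2 hKB l x) (integrable_piece_H4 hd' hRΦ hRF hRΦ2 hRF2 hKB l x)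
    (integrable_piece_H5 hd' hRΦ hRF hRΦ2 hRF2 hKB l x) hH1
    (abs_integral_H2_diagram_le_boundH2_lapAtomsAt hd hKB hr hΓ τ hT l x)
    (abs_integral_H3_diagram_le_boundH3_lapAtomsAt hd hKB τ hU l x)
    (abs_integral_H5_diagram_le_boundH5_lapAtomsAt hd hKB τ hU l x)

/-! ## 2. The witnesses of the extended simplified form, as one record -/

/-- **Coding predicate (not a fact): an admissible witness of the extended simplified form of `τ̂_p` with its key-quantity bounds at the arguments
`r`.**  The twenty conjuncts delivered by `NobleSimplifiedFormF3At.exists_keyBounds_and_split` (module `NobleRemainderSymmetrisation`) for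
coefficients `c_Φ, α_Φ, c_F, α_F` and remainders `R_Φ, R_F`: total reflection symmetry and summability of the remainders, the rewrite
`τ̂_p(k)[1 − F̂(k)] = Φ̂(k)` on the cube, `F̂(0) < 1`, the thirteen Assumption-2.7 bounds at the tables `(B, E)`, the displacement bound
`F̂(0) − F̂(k) ≥ −β̲_{ΔR,F}[1 − D̂(k)]` for the remainder part, and at every `k` of the cube with `D̂(k) < 1` the bounds `LapAtoms.KeyBounds r` of
[NoBLE17] §3.3.4 together with `τ̂_p = Ĝ` and the App.-C split `−Δτ̂_p = Σ_{i=1}^5 Ĥ_i`.  Nothing is asserted: it is the binder type over which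
the Step-1 hypothesis of the assembly is quantified.
[cite: FitznerVanDerHofstad2016NoBLE, Assumption 2.7 (pp. 1059–1060); §3.3.4 (3.40)–(3.57) pp. 1072–1074; App. C] -/
structure NobleF3Witness (d : ℕ) (p : unitInterval) (B : NobleBeta) (E : NobleBetaF3) (r : F3Bounds.Args)
    (cΦ αΦ cF αF : ℝ) (RΦ RF : Site d → ℝ) : Prop where
  trsΦ : IsTRS RΦ
  trsF : IsTRS RF
  summableΦ : Summable RΦ
  summableF : Summable RF
  form : ∀ k ∈ cube d, tauHat d p k * (1 - (cF + αF * Dhat d k + cosFT RF k)) = cΦ + αΦ * Dhat d k + cosFT RΦ k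
  fZero_lt_one : cF + αF + cosFT RF 0 < 1
  cΦ_nonneg : 0 ≤ cΦ
  cΦlow_le : E.cΦlow ≤ cΦ
  cΦ_le : cΦ ≤ B.cΦup
  abs_αΦ_le : |αΦ| ≤ B.βαΦ
  αFlow_le : B.αFlow ≤ αF
  αF_le : αF ≤ E.αFup
  tsum_abs_RΦ_le : ∑' x, |RΦ x| ≤ B.βRΦ
  tsum_abs_RF_le : ∑' x, |RF x| ≤ E.βRF
  summable_normSq_RΦ : Summable fun x => normSq x * |RΦ x|
  tsum_normSq_RΦ_le : ∑' x, normSq x * |RΦ x| ≤ E.βΔRΦ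
  summable_normSq_RF : Summable fun x => normSq x * |RF x|
  tsum_normSq_RF_le : ∑' x, normSq x * |RF x| ≤ E.βΔRFabs
  displacement : ∀ k ∈ cube d, -(B.βΔ * (1 - Dhat d k)) ≤ cosFT RF 0 - cosFT RF k
  keyBounds_split : ∀ k ∈ cube d, Dhat d k < 1 →
    (lapAtomsAt d cΦ αΦ cF αF RΦ RF k).KeyBounds r ∧
    tauHat d p k = (lapAtomsAt d cΦ αΦ cF αF RΦ RF k).G ∧
    tauWHat d p k = (lapAtomsAt d cΦ αΦ cF αF RΦ RF k).H1 + (lapAtomsAt d cΦ αΦ cF αF RΦ RF k).H2 +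
      (lapAtomsAt d cΦ αΦ cF αF RΦ RF k).H3 + (lapAtomsAt d cΦ αΦ cF αF RΦ RF k).H4 +
      (lapAtomsAt d cΦ αΦ cF αF RΦ RF k).H5

/-- **Below `p_c`, under `f₂(p) ≤ Γ₂`, the extended simplified form has an admissible witness at the arguments `NobleBetaF3.toArgs d B E Γ₂`**
(`d ≥ 2`, `0 < α̲_F`, `β̲_{ΔR,F} < α̲_F`) — `NobleSimplifiedFormF3At.exists_keyBounds_and_split` repackaged.
[cite: FitznerVanDerHofstad2016NoBLE, §3.3.4 (3.40)–(3.57) pp. 1072–1074; Assumption 2.7 (pp. 1059–1060)] -/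
theorem NobleSimplifiedFormF3At.exists_witness (hd : 2 ≤ d) {p : unitInterval}
    (hp : (p : ℝ) < criticalProb (zdGraph d) (0 : Site d)) {B : NobleBeta} {E : NobleBetaF3} {Γ₂ : ℝ}
    (hΓ : nobleF2 d p ≤ Γ₂) (hαFlow : 0 < B.αFlow) (hgap : B.βΔ < B.αFlow) (h : NobleSimplifiedFormF3At d p B E) :
    ∃ (cΦ αΦ cF αF : ℝ) (RΦ RF : Site d → ℝ), NobleF3Witness d p B E (NobleBetaF3.toArgs d B E Γ₂) cΦ αΦ cF αF RΦ RF := by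
  obtain ⟨cΦ, αΦ, cF, αF, RΦ, RF, h1, h2, h3, h4, h5, h6, h7, h8, h9, h10, h11, h12, h13, h14, h15, h16, h17, h18,
    h19, h20⟩ := h.exists_keyBounds_and_split hd hp hΓ hαFlow hgap
  exact ⟨cΦ, αΦ, cF, αF, RΦ, RF,
    ⟨h1, h2, h3, h4, h5, h6, h7, h8, h9, h10, h11, h12, h13, h14, h15, h16, h17, h18, h19, h20⟩⟩

namespace NobleF3Witness

variable {p : unitInterval} {B : NobleBeta} {E : NobleBetaF3} {r : F3Bounds.Args} {cΦ αΦ cF αF : ℝ} {RΦ RF : Site d → ℝ}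

/-- The key-quantity bounds of the witness's atoms on the cube off `{D̂ = 1}`. [cite: FitznerVanDerHofstad2016NoBLE, §3.3.4 (3.40)–(3.57) pp. 1072–1074] -/
theorem keyBounds (w : NobleF3Witness d p B E r cΦ αΦ cF αF RΦ RF) :
    ∀ k ∈ cube d, Dhat d k < 1 → (lapAtomsAt d cΦ αΦ cF αF RΦ RF k).KeyBounds r :=
  fun k hk hD => (w.keyBounds_split k hk hD).1

/-- `τ̂_p(k) = Ĝ(k)` on the cube off `{D̂ = 1}`. [cite: FitznerVanDerHofstad2016NoBLE, §3.3.4 (3.46) p. 1072] -/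
theorem tauHat_eq_G (w : NobleF3Witness d p B E r cΦ αΦ cF αF RΦ RF) :
    ∀ k ∈ cube d, Dhat d k < 1 → tauHat d p k = (lapAtomsAt d cΦ αΦ cF αF RΦ RF k).G :=
  fun k hk hD => (w.keyBounds_split k hk hD).2.1

/-- `F̂(0) ≤ 1` (the non-strict form of `fZero_lt_one`, as the Step-1 leaf consumes it). [folklore] -/
theorem fZero_le_one (w : NobleF3Witness d p B E r cΦ αΦ cF αF RΦ RF) : cF + αF + cosFT RF 0 ≤ 1 := w.fZero_lt_one.le

/-- **`|ℋ^{n,l}_p(x)| ≤ boundHD75 τ n l x r` at a witness**, `d ≥ 2n + 7`, given `r.WF`, (H-Γ), the table side and the Step-1 bound at the witness.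
[cite: FitznerVanDerHofstad2016NoBLE, §3.3.5 (3.58)–(3.87) pp. 1074–1079] -/
theorem abs_nobleH_le_boundHD75 (w : NobleF3Witness d p B E r cΦ αΦ cF αF RΦ RF) {n : ℕ} (hd : 2 * (n + 3) + 1 ≤ d)
    (hp : (p : ℝ) < criticalProb (zdGraph d) (0 : Site d)) (hr : r.WF) (hΓ : r.Gamma2dash ^ n * r.bRp ≤ r.bRpDelta)
    (τ : F3Bounds.Tables (Fin d → ℤ)) (hK : ∀ m l x, τ.K m l x = srwK d m l x) (hU : ∀ m l x, τ.U m l x = srwU d m l x)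
    (hT : ∀ m l x, srwTS d r.afmin m l x ≤ τ.T m l x) (l : ℕ) (x : Site d)
    (hH1 : |(∫ k, (lapAtomsAt d cΦ αΦ cF αF RΦ RF k).H1 * (lapAtomsAt d cΦ αΦ cF αF RΦ RF k).G ^ n *
        Dhat d k ^ l * DhatSym d x k ∂P d) / (2 * π) ^ d| ≤ F3Bounds.boundH1 τ n l x r) :
    |nobleH d n l p x| ≤ F3Bounds.boundHD75 τ n l x r :=
  abs_nobleH_le_boundHD75_of_step1 hd hp w.summableΦ w.summableF w.summable_normSq_RΦ w.summable_normSq_RF w.form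
    w.keyBounds hr hΓ τ hK hU hT l x hH1

end NobleF3Witness

/-! ## 3. From the existence of a witness: Step 1 as ONE displayed binder quantified over the witnesses -/

/-- **`|ℋ^{n,l}_p(x)| ≤ boundHD75 τ n l x r`** (`d ≥ 2n + 7`) from the EXISTENCE of an admissible witness at `r` (below `p_c` under `f₂ ≤ Γ₂`:
`NobleSimplifiedFormF3At.exists_witness`), well-formed `r` with (H-Γ), a table `τ` with `K = srwK`, `U = srwU`, `srwTS ≤ T` ((H-T)), and the
STEP-1 BOUND `hStep1` — [NoBLE17] (3.71): `|∫ Ĥ₁ Ĝⁿ D̂^l D̂^{(x)} dk/(2π)^d| ≤ BoundH[1] = F3Bounds.boundH1 τ n l x r` — required of EVERY admissible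
witness (this is the statement the Step-1 leaf proves; DIVERGENCE D80: valid under its displayed table-side conditions).
[cite: FitznerVanDerHofstad2016NoBLE, §3.3.5 (3.58)–(3.59) p. 1074, (3.60)–(3.71) pp. 1075–1076, (3.72)–(3.87) pp. 1076–1079] -/
theorem abs_nobleH_le_boundHD75_of_witness {n : ℕ} (hd : 2 * (n + 3) + 1 ≤ d) {p : unitInterval}
    (hp : (p : ℝ) < criticalProb (zdGraph d) (0 : Site d)) {B : NobleBeta} {E : NobleBetaF3} {r : F3Bounds.Args}
    (hW : ∃ (cΦ αΦ cF αF : ℝ) (RΦ RF : Site d → ℝ), NobleF3Witness d p B E r cΦ αΦ cF αF RΦ RF)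
    (hr : r.WF) (hΓ : r.Gamma2dash ^ n * r.bRp ≤ r.bRpDelta)
    (τ : F3Bounds.Tables (Fin d → ℤ)) (hK : ∀ m l x, τ.K m l x = srwK d m l x) (hU : ∀ m l x, τ.U m l x = srwU d m l x)
    (hT : ∀ m l x, srwTS d r.afmin m l x ≤ τ.T m l x) (l : ℕ) (x : Site d)
    (hStep1 : ∀ ⦃cΦ αΦ cF αF : ℝ⦄ ⦃RΦ RF : Site d → ℝ⦄, NobleF3Witness d p B E r cΦ αΦ cF αF RΦ RF →
      |(∫ k, (lapAtomsAt d cΦ αΦ cF αF RΦ RF k).H1 * (lapAtomsAt d cΦ αΦ cF αF RΦ RF k).G ^ n *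
        Dhat d k ^ l * DhatSym d x k ∂P d) / (2 * π) ^ d| ≤ F3Bounds.boundH1 τ n l x r) :
    |nobleH d n l p x| ≤ F3Bounds.boundHD75 τ n l x r := by
  obtain ⟨cΦ, αΦ, cF, αF, RΦ, RF, w⟩ := hW
  exact w.abs_nobleH_le_boundHD75 hd hp hr hΓ τ hK hU hT l x (hStep1 w)

/-! ## 4. The six cells of `f₃` -/

/-- Pointwise bounds on the cells give `NobleWeightedDiagramBoundAt` (each `sup_{x ∈ S_k}` is a real `iSup`, `0` on `∅`, whence `0 ≤ b_k`). [folklore] -/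
theorem nobleWeightedDiagramBoundAt_of_forall {p : unitInterval} {b : Fin 6 → ℝ} (hb : ∀ k, 0 ≤ b k)
    (h : ∀ k, ∀ x ∈ (nobleTriple d k).2.2, nobleH d (nobleTriple d k).1 (nobleTriple d k).2.1 p x ≤ b k) :
    NobleWeightedDiagramBoundAt d p b :=
  fun k => nobleSupH_le_of_forall (hb k) (h k)

/-- **The six weighted-diagram cells of `f₃` from (3.87)** — `d ≥ 9`, below `p_c`, an admissible witness at well-formed arguments `r` with (H-Γ) at
`n = 0, 1`, a table `τ` with `K = srwK`, `U = srwU`, `srwTS ≤ T`, the Step-1 bound at `n = 0, 1` for every admissible witness, and the six NUMERIC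
cell hypotheses `boundHD75 τ n_k l_k x r ≤ b_k` for `x ∈ S_k`, `(n_k, l_k, S_k) ∈ 𝒮 = {(0,0,𝒳),(1,0,𝒳),(1,1,𝒳),(1,2,𝒳),(1,3,𝒳),(1,6,{0})}` with
`b_k ≥ 0`: then `sup_{x ∈ S_k} ℋ^{n_k,l_k}_p(x) ≤ b_k` for all six cells, i.e. `NobleWeightedDiagramBoundAt d p b`.
[cite: FitznerVanDerHofstad2016NoBLE, §3.3.5 (3.87) p. 1079 with (3.58)–(3.59) p. 1074] [cite: FitznerVanDerHofstad2017, (2.21)–(2.23), §2.5 (EJP pp. 8–9, 11–12)] -/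
theorem nobleWeightedDiagramBoundAt_of_witness (hd : 9 ≤ d) {p : unitInterval}
    (hp : (p : ℝ) < criticalProb (zdGraph d) (0 : Site d)) {B : NobleBeta} {E : NobleBetaF3} {r : F3Bounds.Args}
    (hW : ∃ (cΦ αΦ cF αF : ℝ) (RΦ RF : Site d → ℝ), NobleF3Witness d p B E r cΦ αΦ cF αF RΦ RF)
    (hr : r.WF) (hΓ : ∀ n ≤ 1, r.Gamma2dash ^ n * r.bRp ≤ r.bRpDelta)
    (τ : F3Bounds.Tables (Fin d → ℤ)) (hK : ∀ m l x, τ.K m l x = srwK d m l x) (hU : ∀ m l x, τ.U m l x = srwU d m l x)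
    (hT : ∀ m l x, srwTS d r.afmin m l x ≤ τ.T m l x)
    (hStep1 : ∀ n ≤ 1, ∀ (l : ℕ) (x : Site d), ∀ ⦃cΦ αΦ cF αF : ℝ⦄ ⦃RΦ RF : Site d → ℝ⦄,
      NobleF3Witness d p B E r cΦ αΦ cF αF RΦ RF →
      |(∫ k, (lapAtomsAt d cΦ αΦ cF αF RΦ RF k).H1 * (lapAtomsAt d cΦ αΦ cF αF RΦ RF k).G ^ n *
        Dhat d k ^ l * DhatSym d x k ∂P d) / (2 * π) ^ d| ≤ F3Bounds.boundH1 τ n l x r)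
    {b : Fin 6 → ℝ} (hb : ∀ k, 0 ≤ b k)
    (h0 : ∀ x ∈ calX d, F3Bounds.boundHD75 τ 0 0 x r ≤ b 0) (h1 : ∀ x ∈ calX d, F3Bounds.boundHD75 τ 1 0 x r ≤ b 1)
    (h2 : ∀ x ∈ calX d, F3Bounds.boundHD75 τ 1 1 x r ≤ b 2) (h3 : ∀ x ∈ calX d, F3Bounds.boundHD75 τ 1 2 x r ≤ b 3)
    (h4 : ∀ x ∈ calX d, F3Bounds.boundHD75 τ 1 3 x r ≤ b 4) (h5 : F3Bounds.boundHD75 τ 1 6 0 r ≤ b 5) :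
    NobleWeightedDiagramBoundAt d p b := by
  have hle : ∀ {n : ℕ}, n ≤ 1 → ∀ (l : ℕ) (x : Site d), nobleH d n l p x ≤ F3Bounds.boundHD75 τ n l x r :=
    fun {n} hn l x => (le_abs_self _).trans
      (abs_nobleH_le_boundHD75_of_witness (n := n) (by omega) hp hW hr (hΓ n hn) τ hK hU hT l x (hStep1 n hn l x))
  have hz : (0 : ℕ) ≤ 1 := Nat.zero_le 1
  intro k
  fin_cases k
  · show nobleSupH d 0 0 (calX d) p ≤ b 0
    exact nobleSupH_le_of_forall (hb 0) fun x hx => (hle hz 0 x).trans (h0 x hx)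
  · show nobleSupH d 1 0 (calX d) p ≤ b 1
    exact nobleSupH_le_of_forall (hb 1) fun x hx => (hle le_rfl 0 x).trans (h1 x hx)
  · show nobleSupH d 1 1 (calX d) p ≤ b 2
    exact nobleSupH_le_of_forall (hb 2) fun x hx => (hle le_rfl 1 x).trans (h2 x hx)
  · show nobleSupH d 1 2 (calX d) p ≤ b 3
    exact nobleSupH_le_of_forall (hb 3) fun x hx => (hle le_rfl 2 x).trans (h3 x hx)
  · show nobleSupH d 1 3 (calX d) p ≤ b 4
    exact nobleSupH_le_of_forall (hb 4) fun x hx => (hle le_rfl 3 x).trans (h4 x hx)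
  · show nobleSupH d 1 6 ({0} : Set (Site d)) p ≤ b 5
    exact nobleSupH_le_of_forall (hb 5) fun x hx => by
      rw [Set.mem_singleton_iff] at hx
      subst hx
      exact (hle le_rfl 6 0).trans h5

/-- **The same from the extended simplified form** `NobleSimplifiedFormF3At d p B E` (as delivered from Assumption 4.3 by the App.-D line, or assumed)
below `p_c` under `f₂(p) ≤ Γ₂`, at the arguments `r = NobleBetaF3.toArgs d B E Γ₂` (`0 < α̲_F`, `β̲_{ΔR,F} < α̲_F`).
[cite: FitznerVanDerHofstad2016NoBLE, §3.3.5 (3.87) p. 1079; §3.3.4 pp. 1072–1074] [cite: FitznerVanDerHofstad2017, (2.21)–(2.23), §2.5] -/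
theorem nobleWeightedDiagramBoundAt_of_simplifiedFormF3 (hd : 9 ≤ d) {p : unitInterval}
    (hp : (p : ℝ) < criticalProb (zdGraph d) (0 : Site d)) {B : NobleBeta} {E : NobleBetaF3} {Γ₂ : ℝ}
    (hF3 : NobleSimplifiedFormF3At d p B E) (hΓ2 : nobleF2 d p ≤ Γ₂) (hαFlow : 0 < B.αFlow) (hgap : B.βΔ < B.αFlow)
    (hr : (NobleBetaF3.toArgs d B E Γ₂).WF)
    (hΓ : ∀ n ≤ 1, (NobleBetaF3.toArgs d B E Γ₂).Gamma2dash ^ n * (NobleBetaF3.toArgs d B E Γ₂).bRp ≤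
      (NobleBetaF3.toArgs d B E Γ₂).bRpDelta)
    (τ : F3Bounds.Tables (Fin d → ℤ)) (hK : ∀ m l x, τ.K m l x = srwK d m l x) (hU : ∀ m l x, τ.U m l x = srwU d m l x)
    (hT : ∀ m l x, srwTS d (NobleBetaF3.toArgs d B E Γ₂).afmin m l x ≤ τ.T m l x)
    (hStep1 : ∀ n ≤ 1, ∀ (l : ℕ) (x : Site d), ∀ ⦃cΦ αΦ cF αF : ℝ⦄ ⦃RΦ RF : Site d → ℝ⦄,
      NobleF3Witness d p B E (NobleBetaF3.toArgs d B E Γ₂) cΦ αΦ cF αF RΦ RF →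
      |(∫ k, (lapAtomsAt d cΦ αΦ cF αF RΦ RF k).H1 * (lapAtomsAt d cΦ αΦ cF αF RΦ RF k).G ^ n *
        Dhat d k ^ l * DhatSym d x k ∂P d) / (2 * π) ^ d| ≤ F3Bounds.boundH1 τ n l x (NobleBetaF3.toArgs d B E Γ₂))
    {b : Fin 6 → ℝ} (hb : ∀ k, 0 ≤ b k)
    (h0 : ∀ x ∈ calX d, F3Bounds.boundHD75 τ 0 0 x (NobleBetaF3.toArgs d B E Γ₂) ≤ b 0)
    (h1 : ∀ x ∈ calX d, F3Bounds.boundHD75 τ 1 0 x (NobleBetaF3.toArgs d B E Γ₂) ≤ b 1)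
    (h2 : ∀ x ∈ calX d, F3Bounds.boundHD75 τ 1 1 x (NobleBetaF3.toArgs d B E Γ₂) ≤ b 2)
    (h3 : ∀ x ∈ calX d, F3Bounds.boundHD75 τ 1 2 x (NobleBetaF3.toArgs d B E Γ₂) ≤ b 3)
    (h4 : ∀ x ∈ calX d, F3Bounds.boundHD75 τ 1 3 x (NobleBetaF3.toArgs d B E Γ₂) ≤ b 4)
    (h5 : F3Bounds.boundHD75 τ 1 6 0 (NobleBetaF3.toArgs d B E Γ₂) ≤ b 5) :
    NobleWeightedDiagramBoundAt d p b :=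
  nobleWeightedDiagramBoundAt_of_witness hd hp (hF3.exists_witness (by omega) hp hΓ2 hαFlow hgap) hr hΓ τ hK hU hT
    hStep1 hb h0 h1 h2 h3 h4 h5

/-! ## 5. Packaging as the improvement-step input `NobleImprovementInputsAt` -/

/-- **The improvement-step input of the numeric certificate, from the extended simplified form, Step 1, the table side and the six cells.**
For `d ≥ 9`: if at every `p ∈ (p_I, p_c)` with `f_i(p) ≤ Γ_i` (`i = 1,2,3`) the two-point function has the extended simplified form
`NobleSimplifiedFormF3At d p B E` (the App.-D line from Assumption 4.3, module `NobleAppDKeyBounds`, or displayed), the arguments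
`r = NobleBetaF3.toArgs d B E Γ₂` (`Γ₂ = Γ 1`) are well formed with (H-Γ) at `n = 0, 1`, the table `τ` has `K = srwK`, `U = srwU`, `srwTS ≤ T`,
the Step-1 bound holds at `n = 0, 1` for every admissible witness at every such `p`, and the six cell inequalities `boundHD75 τ n_k l_k x r ≤ b_k`
hold with `b_k ≥ 0`, then `NobleImprovementInputsAt d cμ c Γ B b` (module `NobleInstantiate`): the simplified form by the projection
`NobleSimplifiedFormF3At.toSimplifiedFormAt`, the weighted-diagram bounds by `nobleWeightedDiagramBoundAt_of_simplifiedFormF3`.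
[cite: FitznerVanDerHofstad2016NoBLE, §3.3.5 (3.87) p. 1079; Assumption 2.7 and Prop. 4.5 (pp. 1059–1060, 1088)]
[cite: FitznerVanDerHofstad2017, Prop. 2.1–2.2, (2.21)–(2.23), §2.5] -/
theorem nobleImprovementInputsAt_of_simplifiedFormF3 (hd : 9 ≤ d) {cμ : ℝ} {c : Fin 6 → ℝ} {Γ : Fin 3 → ℝ}
    {B : NobleBeta} {E : NobleBetaF3}
    (hF3 : ∀ p : unitInterval, p ∈ Set.Ioo (nbwThresholdI d) (criticalProbI d) →
      (∀ i, nobleF d cμ c i p ≤ Γ i) → NobleSimplifiedFormF3At d p B E)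
    (hαFlow : 0 < B.αFlow) (hgap : B.βΔ < B.αFlow) (hr : (NobleBetaF3.toArgs d B E (Γ 1)).WF)
    (hΓ : ∀ n ≤ 1, (NobleBetaF3.toArgs d B E (Γ 1)).Gamma2dash ^ n * (NobleBetaF3.toArgs d B E (Γ 1)).bRp ≤
      (NobleBetaF3.toArgs d B E (Γ 1)).bRpDelta)
    (τ : F3Bounds.Tables (Fin d → ℤ)) (hK : ∀ m l x, τ.K m l x = srwK d m l x) (hU : ∀ m l x, τ.U m l x = srwU d m l x)
    (hT : ∀ m l x, srwTS d (NobleBetaF3.toArgs d B E (Γ 1)).afmin m l x ≤ τ.T m l x)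
    (hStep1 : ∀ p : unitInterval, p ∈ Set.Ioo (nbwThresholdI d) (criticalProbI d) → (∀ i, nobleF d cμ c i p ≤ Γ i) →
      ∀ n ≤ 1, ∀ (l : ℕ) (x : Site d), ∀ ⦃cΦ αΦ cF αF : ℝ⦄ ⦃RΦ RF : Site d → ℝ⦄,
      NobleF3Witness d p B E (NobleBetaF3.toArgs d B E (Γ 1)) cΦ αΦ cF αF RΦ RF →
      |(∫ k, (lapAtomsAt d cΦ αΦ cF αF RΦ RF k).H1 * (lapAtomsAt d cΦ αΦ cF αF RΦ RF k).G ^ n *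
        Dhat d k ^ l * DhatSym d x k ∂P d) / (2 * π) ^ d| ≤ F3Bounds.boundH1 τ n l x (NobleBetaF3.toArgs d B E (Γ 1)))
    {b : Fin 6 → ℝ} (hb : ∀ k, 0 ≤ b k)
    (h0 : ∀ x ∈ calX d, F3Bounds.boundHD75 τ 0 0 x (NobleBetaF3.toArgs d B E (Γ 1)) ≤ b 0)
    (h1 : ∀ x ∈ calX d, F3Bounds.boundHD75 τ 1 0 x (NobleBetaF3.toArgs d B E (Γ 1)) ≤ b 1)
    (h2 : ∀ x ∈ calX d, F3Bounds.boundHD75 τ 1 1 x (NobleBetaF3.toArgs d B E (Γ 1)) ≤ b 2)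
    (h3 : ∀ x ∈ calX d, F3Bounds.boundHD75 τ 1 2 x (NobleBetaF3.toArgs d B E (Γ 1)) ≤ b 3)
    (h4 : ∀ x ∈ calX d, F3Bounds.boundHD75 τ 1 3 x (NobleBetaF3.toArgs d B E (Γ 1)) ≤ b 4)
    (h5 : F3Bounds.boundHD75 τ 1 6 0 (NobleBetaF3.toArgs d B E (Γ 1)) ≤ b 5) :
    NobleImprovementInputsAt d cμ c Γ B b := by
  intro p hp hf
  have hF := hF3 p hp hf
  have hpc : (p : ℝ) < criticalProb (zdGraph d) (0 : Site d) := by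
    rw [← coe_criticalProbI]
    exact Subtype.coe_lt_coe.2 hp.2
  have hΓ2 : nobleF2 d p ≤ Γ 1 := by simpa only [nobleF_one] using hf 1
  exact ⟨hF.toSimplifiedFormAt, nobleWeightedDiagramBoundAt_of_simplifiedFormF3 hd hpc hF hΓ2 hαFlow hgap hr hΓ τ hK hU hT
    (hStep1 p hp hf) hb h0 h1 h2 h3 h4 h5⟩

end Literature.Probability.FitznerVanDerHofstad2017

end
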